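import Literature.MathematicalPhysics.QuantumFieldTheory.Balaban1983to89.B4Prop31Regular

/-!
# `Balaban1983to89.B4Prop31Window` — [Balaban1983RegularityDecay] «Proposition 3.1′ of [2]» (1.21)–(1.22) p. 574 WITH
# ONE SET OF CONSTANTS FOR THE WHOLE WINDOW `a_k ∈ [a₋, a₊]`, `m² ∈ [0, m²₊]` of the running parameters (the famF word
# F-windowF of YM-PLAN row N01): the lattice form family of p35 re-indexed by `(a_k, m², instance)` and the typed leaf
# `B4.Prop31Printed (regularFormSettingW …)` with `γ₀`, `e₁`, `C(α)` depending on the window only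

statement-level skeleton of published theorems with citation tags; proofs where landed; nothing here is a claim about
the Yang–Mills mass gap

CITATION HEADER.  T. Bałaban, *Regularity and decay of lattice Green's functions*, Commun. Math. Phys. **89** (1983)
571–597, doi:10.1007/bf01214744 [Balaban1983RegularityDecay] (cell paper B4; held text
`paper:balaban1983-cmp89-regularity-decay`, journal page = PDF page + 570; p. 574 (1.21)–(1.22), p. 573 (1.14) «a_k is a
constant proportional to a», p. 590 «Then γ₀ = ½min{γ₀′/(2d), a_k/(a_k + O(1))}»).  Cell `pub-ymgap`, Track-A seat
`pub-ymgap-dag-n01-b` gen 0 (node N01; the cross-read XREAD-B4 v0.5 §7 flag F-windowF: «`a` (= the a_k of (1.14)) and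
`m²` are FAMILY parameters of famF, so `Prop31Printed (regularFormSetting F a m² C a₀ p)` is certified PER VALUE of
(a_k, m²), not uniformly over the a_k-window `[a(1−L⁻²), a]` that k runs through (famU got a window twin
`regularFieldRegionsW` for exactly this reason; famF did not) … a ≈ S-sized window twin `regularFormSettingW`»; 2NDPASS
v1.0 §B: count-neutral).  USED BY NAME: p35's `B4Prop31Regular.{RegularFormInstance, regularFormSetting,
form122_lattice}` (the explicit-constant (1.22) in lattice units), `B4Lower18Regular.threshold_exists`,
`B2Sect3AGaussianStep.one_add_log_inv_rpow_mul_rpow_le`.  One dictionary `structure` + one reducible family `def` +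
theorems; no `Prop`-valued fact, no `sorry`, axioms standard.

WHAT IS PRINTED (p. 574, verbatim).  «Proposition 3.1′ of [2]: … then there exists a positive constant γ₀ depending on d
only, such that for e sufficiently small ⟨φ, Δ^{(k)}(Ω,A)φ⟩ ≥ γ₀(Σ_{⟨x,x′⟩⊂Ω^{(k)}}|U(A(⟨x,x′⟩))φ(x′) − φ(x)|² +
m²Σ_{x∈Ω^{(k)}}|φ(x)|²) − O(1)e^{2−α}Σ_{x∈Ω^{(k)}}|φ(x)|² (1.22) for arbitrary α > 0 and a constant O(1) depending on α
and the other constants, but independent of Ω, k, A, and for an arbitrary function φ.»  The printed γ₀ is uniform in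
`k`; its own §4 value «½min{γ₀′/(2d), a_k/(a_k + O(1))}» («if m² ≤ O(1)», (4.4)) is monotone in `a_k` and `m²`, so ONE
constant serves the window — this file performs that monotonicity in the kernel.

WHAT THIS MODULE PROVES (all in full).
* §1 `RegularFormIdxW`, `regularFormSettingW` — p35's regular-region carriers indexed by `(a_k ∈ [a₋,a₊], m² ∈ [0,m²₊],
  (n, Ω^{(k)}, e, A))`; `regularFormSettingW_eq` (each member IS p35's `regularFormSetting F a_k m² C a₀ p` member).
* §2 **`prop31Printed_regularWindow`**: `B4.Prop31Printed (regularFormSettingW F a₋ a₊ m²₊ C a₀ p)` for every Lipschitz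
  orthogonal flow, `0 < a₋ ≤ a₊`, `m²₊ ≥ 0`, `C, a₀ ≥ 0`, `p > 0`, with the WINDOW constants
  `γ₀ = 1/max((6(d+1)+2m²₊)/a₋, 24)`, `e₁ = min(1, e₁(ℓ(1+a₊(d+1)), (d+1)Ca₀max(1,2p)^p, a₋, ½))`,
  `C(α) = (1/24)·6(d+1)(4a₊/min(2,a₋))²·ℓ²((3d+4)Ca₀)²·max(1,2p/α)^{2p}` — p35's `form122_lattice` at the member's
  `(a_k, m²)` and the monotonicity of its explicit constants over the window.
HONEST SCOPE.  No new estimate: p35's (1.22) with its constants majorised over the window; `γ₀` depends on `(d, a₋, m²₊)`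
(print: «depending on d only» — p35's HONEST LABEL, unchanged).  Count-neutral for YM-PLAN (typed 28∕28 · discharged
0∕28 unmoved); nothing here concerns the continuum, ℝ⁴, OS axioms, a mass gap or the Clay problem.
-/

namespace Literature.MathematicalPhysics.QuantumFieldTheory.Balaban1983to89.B4Prop31Window

open Matrix Finset
open Literature.MathematicalPhysics.QuantumFieldTheory.Balaban1983to89
open Literature.MathematicalPhysics.QuantumFieldTheory.Balaban1983to89.B4GaugeCovariance
open Literature.MathematicalPhysics.QuantumFieldTheory.Balaban1983to89.B4Lower18 (fineDom)
open Literature.MathematicalPhysics.QuantumFieldTheory.Balaban1983to89.B4Lower18Regular (e1 dotProduct_self_nonneg'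
  threshold_exists)
open Literature.MathematicalPhysics.QuantumFieldTheory.Balaban1983to89.B4Lower18RegularRegion (regWt rBlkWt)
open Literature.MathematicalPhysics.QuantumFieldTheory.Balaban1983to89.B4Prop31Energy (keff)
open Literature.MathematicalPhysics.QuantumFieldTheory.Balaban1983to89.B4Prop31Charts (linkR transR covDiffSq)
open Literature.MathematicalPhysics.QuantumFieldTheory.Balaban1983to89.B4Prop31Regular (RegularFormInstance
  regularFormSetting form122_lattice)
open Literature.MathematicalPhysics.QuantumFieldTheory.Balaban1983to89.B2Sect3AGaussianStep
  (one_add_log_inv_rpow_mul_rpow_le)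

noncomputable section

variable {d : ℕ} {ι : Type} [Fintype ι] [DecidableEq ι]

/-! ## §1. The regular-region family indexed over the window of running parameters -/

/-- AN INDEX of the window family: the running averaging coefficient `a_k ∈ [a₋, a₊]` (print p. 573: «a_k is a constant
proportional to a»; the window `[a(1−L⁻²), a]` of [1] (2.15)), the mass `m² ∈ [0, m²₊]` («if m² ≤ O(1)», (4.4) p. 589),
and p35's instance `(n, Ω^{(k)}, e, A)`. [cite: Balaban1983RegularityDecay, p. 573 (1.14), p. 574 (1.21)–(1.22), dictionary] -/
structure RegularFormIdxW (d : ℕ) (amin aplus m2plus : ℝ) where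
  /-- the running coefficient `a_k` -/
  ak : ℝ
  hak : amin ≤ ak
  hak' : ak ≤ aplus
  /-- the mass `m²` -/
  m2 : ℝ
  hm2 : 0 ≤ m2
  hm2' : m2 ≤ m2plus
  /-- p35's instance: mesh, unit labels, charge, vector field -/
  inst : RegularFormInstance d

/-- **THE WINDOW FAMILY** for «Proposition 3.1′ of [2]»: the member at `(a_k, m², i)` IS p35's regular-region carrier
`regularFormSetting F a_k m² C a₀ p i` (same `Cfg`, `reg121`, `form`, `covDiffSq`, `l2sq`).
[cite: Balaban1983RegularityDecay, p. 574 (1.21)–(1.22) with p. 573 (1.14), dictionary] -/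
@[reducible] def regularFormSettingW (F : OrthFlow ι) (amin aplus m2plus C a₀ p : ℝ)
    (i : RegularFormIdxW d amin aplus m2plus) : B4.FormSetting :=
  regularFormSetting F i.ak i.m2 C a₀ p i.inst

/-- the window member is p35's member (definitional). [cite: Balaban1983RegularityDecay, p. 574 (1.22), dictionary] -/
theorem regularFormSettingW_eq (F : OrthFlow ι) (amin aplus m2plus C a₀ p : ℝ)
    (i : RegularFormIdxW d amin aplus m2plus) :
    regularFormSettingW F amin aplus m2plus C a₀ p i = regularFormSetting F i.ak i.m2 C a₀ p i.inst := rfl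

/-! ## §2. «Proposition 3.1′ of [2]» with window-uniform constants -/

/-- **THEOREM («PROPOSITION 3.1′ OF [2]» TYPED, WINDOW-UNIFORM: ONE `γ₀`, ONE THRESHOLD `e₁` AND ONE `C(α)` FOR ALL
`a_k ∈ [a₋, a₊]`, `m² ∈ [0, m²₊]`, ALL MESHES, ALL FINITE UNIONS OF UNIT BLOCKS, ALL CHARGES, ALL VECTOR FIELDS)**: for a
Lipschitz orthogonal flow, `0 < a₋ ≤ a₊`, `C, a₀ ≥ 0`, `p > 0`, the verbatim-typed `B4.Prop31Printed` HOLDS on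
`regularFormSettingW F a₋ a₊ m²₊ C a₀ p`, with `γ₀ = 1/max((6(d+1)+2m²₊)/a₋, 24)` and `C(α) =
(1/24)·6(d+1)(4a₊/min(2,a₋))²ℓ²((3d+4)Ca₀)²max(1,2p/α)^{2p}` — p35's `form122_lattice` at the member's `(a_k, m²)`, its
constants majorised over the window (`1/max((6(d+1)+2m²)/a_k, 24)` is increasing in `a_k`, decreasing in `m²`;
`γ_H = min(2,a_k)/4 + m² ≥ min(2,a₋)/4`).  HONEST LABEL: `γ₀` depends on `(d, a₋, m²₊)` (print: «on d only»).
[cite: Balaban1983RegularityDecay, Prop. 3.1′ of [2] (1.21)–(1.22) p.574; p.590 «γ₀ = ½min{γ₀′/(2d), a_k/(a_k + O(1))}»] -/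
theorem prop31Printed_regularWindow (F : OrthFlow ι) {ℓ : ℝ} (hℓ : 0 ≤ ℓ)
    (hLip : ∀ t (v : ι → ℝ), ((F.U t - 1) *ᵥ v) ⬝ᵥ ((F.U t - 1) *ᵥ v) ≤ (ℓ * t) ^ 2 * (v ⬝ᵥ v))
    {amin aplus m2plus : ℝ} (ha : 0 < amin) (hap : amin ≤ aplus) {C : ℝ} (hC : 0 ≤ C) {a₀ : ℝ}
    (ha₀ : 0 ≤ a₀) {p : ℝ} (hp : 0 < p) :
    B4.Prop31Printed (regularFormSettingW (d := d) F amin aplus m2plus C a₀ p) := by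
  -- the window constants
  set c₁ : ℝ := max ((6 * (d + 1) + 2 * m2plus) / amin) 24 with hc₁_def
  have hc₁ : 0 < c₁ := lt_of_lt_of_le (by norm_num) (le_max_right _ _)
  set γw : ℝ := min 2 amin / 4 with hγw_def
  have hγw : 0 < γw := div_pos (lt_min two_pos ha) four_pos
  have hapos : 0 < aplus := lt_of_lt_of_le ha hap
  set c' : ℝ := (d + 1) * C * (a₀ * max 1 (p / (1 / 2)) ^ p) with hc'
  have hD1 : (1 : ℝ) ≤ 1 + aplus * (d + 1) := by
    have : (0 : ℝ) ≤ aplus * (d + 1) := by positivity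
    linarith
  obtain ⟨e₁, he₁, hsm⟩ := threshold_exists (ℓ * (1 + aplus * (d + 1))) c' ha (β := (1 / 2 : ℝ)) (by norm_num) d
  refine ⟨c₁⁻¹, min 1 e₁, inv_pos.2 hc₁, lt_min one_pos he₁, fun α hα => ?_⟩
  set Cα : ℝ := (24 : ℝ)⁻¹ * (6 * (d + 1) * (aplus / γw) ^ 2 *
    (ℓ ^ 2 * ((3 * d + 4) * C * a₀) ^ 2 * max 1 (2 * p / α) ^ (2 * p))) with hCα
  refine ⟨Cα, by positivity, ?_⟩
  intro i _ hreg he hle ψ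
  -- the member's data
  have hak0 : 0 < i.ak := lt_of_lt_of_le ha i.hak
  change 0 < i.inst.e at he
  change i.inst.e ≤ min 1 e₁ at hle
  change ∀ x ∈ fineDom i.inst.n i.inst.Ωc, ∀ μ ν : Fin (d + 1),
    |i.inst.Ac (x + e1 μ) ν - i.inst.Ac x ν| ≤ C * B2.pFn a₀ p i.inst.e / i.inst.n at hreg
  have he1 : i.inst.e ≤ 1 := hle.trans (min_le_left _ _)
  have hle' : i.inst.e ≤ e₁ := hle.trans (min_le_right _ _)
  have hn0 : (0 : ℝ) < i.inst.n := by exact_mod_cast i.inst.hn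
  -- the logarithmic factor of (1.21)
  set Lg : ℝ := 1 + Real.log i.inst.e⁻¹ with hLg
  have hLg0 : 0 ≤ Lg := by
    rw [hLg, Real.log_inv]
    have := Real.log_nonpos he.le he1
    linarith
  have hpFn : B2.pFn a₀ p i.inst.e = a₀ * Lg ^ p := rfl
  rw [hpFn] at hreg
  -- δ, θ
  set δ : ℝ := C * (a₀ * Lg ^ p) / i.inst.n with hδ_def
  have hδ : 0 ≤ δ := by positivity
  set θ : ℝ := c' * i.inst.e ^ (1 / 2 : ℝ) with hθ_def
  have hθ : 0 ≤ θ := by positivity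
  have hlog1 := one_add_log_inv_rpow_mul_rpow_le hp (by norm_num : (0 : ℝ) < 1 / 2) he he1
  have hκ : |i.inst.e / i.inst.n| = i.inst.e / i.inst.n := abs_of_pos (div_pos he hn0)
  have hesplit : i.inst.e = i.inst.e ^ (1 / 2 : ℝ) * i.inst.e ^ (1 / 2 : ℝ) := by
    rw [← Real.rpow_add he]
    norm_num
  have hκθ : |i.inst.e / i.inst.n| * ((d + 1) * i.inst.n * δ) ≤ θ / i.inst.n := by
    rw [hκ, hδ_def, hθ_def, hc']
    have key : i.inst.e * Lg ^ p ≤ max 1 (p / (1 / 2)) ^ p * i.inst.e ^ (1 / 2 : ℝ) := by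
      calc i.inst.e * Lg ^ p = (Lg ^ p * i.inst.e ^ (1 / 2 : ℝ)) * i.inst.e ^ (1 / 2 : ℝ) := by
            conv_lhs => rw [hesplit]
            ring
        _ ≤ max 1 (p / (1 / 2)) ^ p * i.inst.e ^ (1 / 2 : ℝ) :=
            mul_le_mul_of_nonneg_right hlog1 (Real.rpow_nonneg he.le _)
    have hDC : 0 ≤ ((d : ℝ) + 1) * C * a₀ / i.inst.n := by positivity
    calc i.inst.e / i.inst.n * ((d + 1) * i.inst.n * (C * (a₀ * Lg ^ p) / i.inst.n))
        = (((d : ℝ) + 1) * C * a₀ / i.inst.n) * (i.inst.e * Lg ^ p) := by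
          field_simp
      _ ≤ (((d : ℝ) + 1) * C * a₀ / i.inst.n) * (max 1 (p / (1 / 2)) ^ p * i.inst.e ^ (1 / 2 : ℝ)) :=
          mul_le_mul_of_nonneg_left key hDC
      _ = (d + 1) * C * (a₀ * max 1 (p / (1 / 2)) ^ p) * i.inst.e ^ (1 / 2 : ℝ) / i.inst.n := by ring
  -- the window smallness implies the member's smallness
  have hsm' := hsm i.inst.e he hle'
  have hsmall : ℓ ^ 2 * θ ^ 2 * (d + 1) * (1 + i.ak * (d + 1)) ≤ min 2 i.ak / 4 := by
    have hmin : min 2 amin / 4 ≤ min 2 i.ak / 4 :=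
      div_le_div_of_nonneg_right (min_le_min le_rfl i.hak) (by norm_num)
    have hDa : 1 + i.ak * ((d : ℝ) + 1) ≤ 1 + aplus * (d + 1) := by
      have := mul_le_mul_of_nonneg_right i.hak' (by positivity : (0 : ℝ) ≤ (d : ℝ) + 1)
      linarith
    have hDm : (1 : ℝ) ≤ 1 + amin * (d + 1) := by
      have : (0 : ℝ) ≤ amin * (d + 1) := by positivity
      linarith
    have hbase : 0 ≤ ℓ ^ 2 * θ ^ 2 * ((d : ℝ) + 1) := by positivity
    calc ℓ ^ 2 * θ ^ 2 * (d + 1) * (1 + i.ak * (d + 1))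
        ≤ ℓ ^ 2 * θ ^ 2 * (d + 1) * (1 + aplus * (d + 1)) := mul_le_mul_of_nonneg_left hDa hbase
      _ ≤ ℓ ^ 2 * θ ^ 2 * (d + 1) * (1 + aplus * (d + 1)) * ((1 + aplus * (d + 1)) * (1 + amin * (d + 1))) := by
          have h1 : (1 : ℝ) ≤ (1 + aplus * (d + 1)) * (1 + amin * (d + 1)) := one_le_mul_of_one_le_of_one_le hD1 hDm
          have h0 : 0 ≤ ℓ ^ 2 * θ ^ 2 * ((d : ℝ) + 1) * (1 + aplus * (d + 1)) :=
            mul_nonneg hbase (le_trans zero_le_one hD1)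
          exact le_mul_of_one_le_right h0 h1
      _ = (ℓ * (1 + aplus * (d + 1))) ^ 2 * (c' * i.inst.e ^ (1 / 2 : ℝ)) ^ 2 * (d + 1) * (1 + amin * (d + 1)) := by
          rw [hθ_def]; ring
      _ ≤ min 2 amin / 4 := hsm'
      _ ≤ min 2 i.ak / 4 := hmin
  -- p35's lattice (1.22) at the member
  have key := form122_lattice F hℓ hLip (i.inst.e / i.inst.n) i.inst.hn hak0 i.hm2 i.inst.Ωc i.inst.Ac hδ hθ hreg
    hκθ hsmall ψ
  -- abbreviations
  set c₁i : ℝ := max ((6 * (d + 1) + 2 * i.m2) / i.ak) 24 with hc₁i_def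
  have hc₁i : 0 < c₁i := lt_of_lt_of_le (by norm_num) (le_max_right _ _)
  set γi : ℝ := min 2 i.ak / 4 + i.m2 with hγi_def
  have hγi : γw ≤ γi := by
    have hmin : min 2 amin / 4 ≤ min 2 i.ak / 4 :=
      div_le_div_of_nonneg_right (min_le_min le_rfl i.hak) (by norm_num)
    have := i.hm2
    rw [hγw_def, hγi_def]; linarith
  have hγi0 : 0 < γi := lt_of_lt_of_le hγw hγi
  set S := ψ ⬝ᵥ ψ with hS_def
  set D := covDiffSq F (i.inst.e / i.inst.n) i.inst.Ac i.inst.n i.inst.Ωc ψ with hD_def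
  have hS : 0 ≤ S := dotProduct_self_nonneg' ψ
  have hD : 0 ≤ D := by
    rw [hD_def]; unfold covDiffSq
    refine Finset.sum_nonneg fun y _ => Finset.sum_nonneg fun μ _ => ?_
    split_ifs
    · exact dotProduct_self_nonneg' _
    · exact le_rfl
  -- monotonicity of γ₀: c₁i ≤ c₁
  have hc₁le : c₁i ≤ c₁ := by
    rw [hc₁i_def, hc₁_def]
    refine max_le_max ?_ le_rfl
    have hnum : (6 * ((d : ℝ) + 1) + 2 * i.m2) ≤ 6 * (d + 1) + 2 * m2plus := by linarith [i.hm2']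
    have hnum0 : 0 ≤ 6 * ((d : ℝ) + 1) + 2 * i.m2 := by have := i.hm2; positivity
    exact div_le_div₀ (by linarith) hnum ha i.hak
  have hpos_part : c₁⁻¹ * (D + i.m2 * S) ≤ c₁i⁻¹ * (D + i.m2 * S) :=
    mul_le_mul_of_nonneg_right (inv_anti₀ hc₁i hc₁le) (add_nonneg hD (mul_nonneg i.hm2 hS))
  -- the error coefficient is ≤ C(α) e^{2−α}
  have hω : (ℓ * (|i.inst.e / i.inst.n| * ((3 * d + 4) * i.inst.n ^ 2 * δ))) ^ 2
      = ℓ ^ 2 * ((3 * d + 4) * C * a₀) ^ 2 * (i.inst.e ^ 2 * Lg ^ (2 * p)) := by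
    rw [hκ, hδ_def]
    have hsq : (Lg ^ p) ^ 2 = Lg ^ (2 * p) := by
      rw [show (2 : ℝ) * p = p * 2 by ring, Real.rpow_mul hLg0, Real.rpow_two]
    rw [← hsq]
    field_simp
  have hlog2 := one_add_log_inv_rpow_mul_rpow_le (p := 2 * p) (s := α) (by positivity) hα he he1
  have herr : i.inst.e ^ 2 * Lg ^ (2 * p) ≤ max 1 (2 * p / α) ^ (2 * p) * i.inst.e ^ ((2 : ℝ) - α) := by
    have h2 : i.inst.e ^ 2 = i.inst.e ^ ((2 : ℝ) - α) * i.inst.e ^ α := by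
      rw [← Real.rpow_add he, sub_add_cancel, Real.rpow_two]
    rw [h2]
    calc i.inst.e ^ ((2 : ℝ) - α) * i.inst.e ^ α * Lg ^ (2 * p)
        = (Lg ^ (2 * p) * i.inst.e ^ α) * i.inst.e ^ ((2 : ℝ) - α) := by ring
      _ ≤ max 1 (2 * p / α) ^ (2 * p) * i.inst.e ^ ((2 : ℝ) - α) :=
          mul_le_mul_of_nonneg_right hlog2 (Real.rpow_nonneg he.le _)
  have hratio : (i.ak / γi) ^ 2 ≤ (aplus / γw) ^ 2 := by
    have h1 : i.ak / γi ≤ aplus / γw := div_le_div₀ hapos.le i.hak' hγw hγi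
    have h0 : 0 ≤ i.ak / γi := div_nonneg hak0.le hγi0.le
    exact pow_le_pow_left₀ h0 h1 2
  have hc₁i24 : c₁i⁻¹ ≤ (24 : ℝ)⁻¹ := inv_anti₀ (by norm_num) (le_max_right _ _)
  have hcoef : c₁i⁻¹ * (6 * (d + 1) * (i.ak / γi) ^ 2 *
      (ℓ * (|i.inst.e / i.inst.n| * ((3 * d + 4) * i.inst.n ^ 2 * δ))) ^ 2) ≤ Cα * i.inst.e ^ ((2 : ℝ) - α) := by
    rw [hω, hCα]
    have hA : 0 ≤ 6 * ((d : ℝ) + 1) := by positivity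
    have hB : 0 ≤ ℓ ^ 2 * ((3 * (d : ℝ) + 4) * C * a₀) ^ 2 := by positivity
    have hE : 0 ≤ i.inst.e ^ 2 * Lg ^ (2 * p) := by positivity
    have step1 : c₁i⁻¹ * (6 * (d + 1) * (i.ak / γi) ^ 2 * (ℓ ^ 2 * ((3 * d + 4) * C * a₀) ^ 2 *
        (i.inst.e ^ 2 * Lg ^ (2 * p))))
        ≤ (24 : ℝ)⁻¹ * (6 * (d + 1) * (aplus / γw) ^ 2 * (ℓ ^ 2 * ((3 * d + 4) * C * a₀) ^ 2 *
        (max 1 (2 * p / α) ^ (2 * p) * i.inst.e ^ ((2 : ℝ) - α)))) := by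
      have hx : 6 * ((d : ℝ) + 1) * (i.ak / γi) ^ 2 * (ℓ ^ 2 * ((3 * d + 4) * C * a₀) ^ 2 *
          (i.inst.e ^ 2 * Lg ^ (2 * p)))
          ≤ 6 * (d + 1) * (aplus / γw) ^ 2 * (ℓ ^ 2 * ((3 * d + 4) * C * a₀) ^ 2 *
          (max 1 (2 * p / α) ^ (2 * p) * i.inst.e ^ ((2 : ℝ) - α))) := by
        have h1 := mul_le_mul_of_nonneg_left herr hB
        have h2 := mul_le_mul_of_nonneg_left hratio hA
        have h3 : 0 ≤ 6 * ((d : ℝ) + 1) * (aplus / γw) ^ 2 := by positivity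
        have h4 : 0 ≤ ℓ ^ 2 * ((3 * (d : ℝ) + 4) * C * a₀) ^ 2 * (i.inst.e ^ 2 * Lg ^ (2 * p)) := mul_nonneg hB hE
        calc 6 * ((d : ℝ) + 1) * (i.ak / γi) ^ 2 * (ℓ ^ 2 * ((3 * d + 4) * C * a₀) ^ 2 * (i.inst.e ^ 2 * Lg ^ (2 * p)))
            ≤ 6 * (d + 1) * (aplus / γw) ^ 2 * (ℓ ^ 2 * ((3 * d + 4) * C * a₀) ^ 2 * (i.inst.e ^ 2 * Lg ^ (2 * p))) :=
              mul_le_mul_of_nonneg_right h2 h4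
          _ ≤ 6 * (d + 1) * (aplus / γw) ^ 2 * (ℓ ^ 2 * ((3 * d + 4) * C * a₀) ^ 2 *
              (max 1 (2 * p / α) ^ (2 * p) * i.inst.e ^ ((2 : ℝ) - α))) := mul_le_mul_of_nonneg_left h1 h3
      have hy : 0 ≤ 6 * ((d : ℝ) + 1) * (aplus / γw) ^ 2 * (ℓ ^ 2 * ((3 * d + 4) * C * a₀) ^ 2 *
          (max 1 (2 * p / α) ^ (2 * p) * i.inst.e ^ ((2 : ℝ) - α))) := by positivity
      calc c₁i⁻¹ * (6 * ((d : ℝ) + 1) * (i.ak / γi) ^ 2 * (ℓ ^ 2 * ((3 * d + 4) * C * a₀) ^ 2 *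
            (i.inst.e ^ 2 * Lg ^ (2 * p))))
          ≤ c₁i⁻¹ * (6 * (d + 1) * (aplus / γw) ^ 2 * (ℓ ^ 2 * ((3 * d + 4) * C * a₀) ^ 2 *
            (max 1 (2 * p / α) ^ (2 * p) * i.inst.e ^ ((2 : ℝ) - α)))) :=
              mul_le_mul_of_nonneg_left hx (inv_nonneg.2 hc₁i.le)
        _ ≤ (24 : ℝ)⁻¹ * (6 * (d + 1) * (aplus / γw) ^ 2 * (ℓ ^ 2 * ((3 * d + 4) * C * a₀) ^ 2 *
            (max 1 (2 * p / α) ^ (2 * p) * i.inst.e ^ ((2 : ℝ) - α)))) := mul_le_mul_of_nonneg_right hc₁i24 hy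
    have e1' : c₁i⁻¹ * (6 * ((d : ℝ) + 1) * (i.ak / γi) ^ 2 *
        (ℓ ^ 2 * ((3 * d + 4) * C * a₀) ^ 2 * (i.inst.e ^ 2 * Lg ^ (2 * p))))
        = c₁i⁻¹ * (6 * (d + 1) * (i.ak / γi) ^ 2 * (ℓ ^ 2 * ((3 * d + 4) * C * a₀) ^ 2 *
          (i.inst.e ^ 2 * Lg ^ (2 * p)))) := rfl
    have e2' : (24 : ℝ)⁻¹ * (6 * ((d : ℝ) + 1) * (aplus / γw) ^ 2 * (ℓ ^ 2 * ((3 * d + 4) * C * a₀) ^ 2 *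
        (max 1 (2 * p / α) ^ (2 * p) * i.inst.e ^ ((2 : ℝ) - α))))
        = (24 : ℝ)⁻¹ * (6 * (d + 1) * (aplus / γw) ^ 2 *
          (ℓ ^ 2 * ((3 * d + 4) * C * a₀) ^ 2 * max 1 (2 * p / α) ^ (2 * p))) * i.inst.e ^ ((2 : ℝ) - α) := by ring
    rw [e2'] at step1
    exact step1
  have hprod := mul_le_mul_of_nonneg_right hcoef hS
  change c₁⁻¹ * (D + i.m2 * S) - Cα * i.inst.e ^ ((2 : ℝ) - α) * S
    ≤ ψ ⬝ᵥ (keff (regWt i.inst.n (fineDom i.inst.n i.inst.Ωc)) i.m2 i.ak ((i.inst.n : ℝ) ^ (d + 1))⁻¹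
      (rBlkWt i.inst.n i.inst.Ωc (fineDom i.inst.n i.inst.Ωc)) (linkR F (i.inst.e / i.inst.n) i.inst.n i.inst.Ωc i.inst.Ac)
      (transR F (i.inst.e / i.inst.n) i.inst.hn i.inst.Ωc i.inst.Ac) *ᵥ ψ)
  linarith [key, hprod, hpos_part]

end

end Literature.MathematicalPhysics.QuantumFieldTheory.Balaban1983to89.B4Prop31Window
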